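import Summits.QuantumFields.YangMills.Theorems.ColdStartUniversalityLatticeLangevinGroundStateGen
import Summits.QuantumFields.YangMills.Theorems.ColdStartUniversalityLatticeLangevinDynkinSeparable
import HarnessLib

/-!
# Route `ColdStartUniversality`, crux K_A1 `UniformColdStartMixing` (stmt-QuantumFields-24809), rung `stub_fixedCutoffMixing`:
# (Inv) wall, step A — the ground-state Duhamel identity

Helper file (seat `ym-line-csu-p1`, g8).  For the SU(2) SZZ system at coupling `β'` (solution family `X` with the regular-flow
clause), a ridge-form function `w = Σ_l c_l F_l` (`F_l = ∏_e U_{m_{l,e}}(⟨ρ g_{l,e}, ρ ·⟩/2)`, eigenvalues `-λ_l` of the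
`β' = 0` generator), the ground state `φ̂ = exp(-ψ̂/2)` and the ground-state potential `V̂ = ½ 𝓛_0 ψ̂ + ⅛ Γ(ψ̂,ψ̂)`:

  `E[φ̂ w (X^x_t)] = φ̂(x) (T̂_t w)(x) - ∫₀ᵗ E[(φ̂ · V̂ · T̂_{t-s} w)(X^x_s)] ds`,   `T̂_τ w := Σ_l c_l e^{-λ_l τ} F_l`

(`groundState_duhamel`), together with the continuity of the `ds`-integrand in `s`.  This is the EQUALITY form of the
supersolution computation `groundState_supersolution` (there with a weight `e^{Ks}` and an inequality): the time-dependent Dynkin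
formula `dynkin_separable` for `u(s,·) = φ̂ Σ_l c_l e^{-λ_l(t-s)} F̂_l` (cut off), whose `(∂_s + 𝓛_{β'})`-image at group points is
`-φ̂ V̂ T̂_{t-s} w` by `generator_groundState_ridge`.  It is the first step of the Duhamel/Grönwall proof of the invariance of the
Wilson measure (SZZ Lemma 3.3) for all `β'`.  No definition, no sorry.  RECORD-rung R3 plumbing; nothing here bears on the mass gap.
-/

set_option autoImplicit false

noncomputable section

namespace Summit.QuantumFields.YangMills.Theorems.ColdStartUniversality

open MeasureTheory Finset Metric Filter
open scoped BigOperators Topology NNReal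
open Literature.Probability.Process Literature.MathematicalPhysics.QuantumFieldTheory Literature.Analysis.SpecialFunctions
open Literature.MathematicalPhysics.QuantumLattice (fundamentalRep fundamentalLatticeRep)

variable {L : ℕ} [NeZero L]

/-- **Ground-state Duhamel identity.**  See the module docstring. [folklore] -/
theorem groundState_duhamel (β' : ℝ)
    {Ω : Type} [MeasurableSpace Ω] {P : Measure Ω} [IsProbabilityMeasure P]
    {W : ℝ≥0 → Ω → (Edge 3 L × NoiseIdx 2 → ℝ)} (hW : IsFlatBrownian W P)
    (U : GaugeConfig 3 L (Matrix.specialUnitaryGroup (Fin 2) ℂ) → ℝ≥0 → Ω →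
      GaugeConfig 3 L (Matrix.specialUnitaryGroup (Fin 2) ℂ))
    (hU : ∀ x, (∀ ω, U x 0 ω = x) ∧
      (latticeLangevinDynamics (fundamentalLatticeRep 2) β').IsSolution (fundamentalRep (Fin 2))
        hW.natFiltration P W (U x))
    (hUm : ∀ i : ℝ≥0, Measurable[@Prod.instMeasurableSpace (Set.Iic i)
        (GaugeConfig 3 L (Matrix.specialUnitaryGroup (Fin 2) ℂ) × Ω) inferInstance
        (@Prod.instMeasurableSpace (GaugeConfig 3 L (Matrix.specialUnitaryGroup (Fin 2) ℂ)) Ω inferInstance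
          (hW.natFiltration i))]
      (fun q : Set.Iic i × (GaugeConfig 3 L (Matrix.specialUnitaryGroup (Fin 2) ℂ) × Ω) => U q.2.1 q.1 q.2.2))
    {κ : Type} [Fintype κ] (c : κ → ℝ) (g : κ → Edge 3 L → Matrix.specialUnitaryGroup (Fin 2) ℂ) (m : κ → Edge 3 L → ℕ)
    (x : GaugeConfig 3 L (Matrix.specialUnitaryGroup (Fin 2) ℂ)) (t : ℝ≥0) :
    let ψV : GaugeConfig 3 L (Matrix.specialUnitaryGroup (Fin 2) ℂ) → ℝ := fun V =>
      β' * ∑ p : Plaquette 3 L, (rootedLoop (fun (e : Edge 3 L) (i j : Fin 2) =>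
        ((((fundamentalRep (Fin 2) (V e) : Matrix (Fin 2) (Fin 2) ℂ) i j).re : ℝ) : ℂ) +
          ((((fundamentalRep (Fin 2) (V e) : Matrix (Fin 2) (Fin 2) ℂ) i j).im : ℝ) : ℂ) * Complex.I)
        (p.1, p.2.1.1) p.2.1.2 false).trace.re
    let Vh : GaugeConfig 3 L (Matrix.specialUnitaryGroup (Fin 2) ℂ) → ℝ := fun V =>
      (let x : (Edge 3 L × Fin 2 × Fin 2 × Bool) → ℝ := fun q =>
          (fun z : ℂ => if q.2.2.2 then z.im else z.re)
            ((fundamentalRep (Fin 2) (V q.1) : Matrix (Fin 2) (Fin 2) ℂ) q.2.1 q.2.2.1)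
       let b₀ : (Edge 3 L × Fin 2 × Fin 2 × Bool) → ℝ := fun q =>
          (fun z : ℂ => if q.2.2.2 then z.im else z.re) ((latticeLangevinDynamics (fundamentalLatticeRep 2) 0).drift
            (matrixConfig (fundamentalRep (Fin 2)) V) q.1 q.2.1 q.2.2.1)
       let σ : (Edge 3 L × Fin 2 × Fin 2 × Bool) → (Edge 3 L × NoiseIdx 2) → ℝ := fun q k =>
          if k.1 = q.1 then (fun z : ℂ => if q.2.2.2 then z.im else z.re)
            ((latticeLangevinDynamics (fundamentalLatticeRep 2) 0).noise
              (matrixConfig (fundamentalRep (Fin 2)) V) q.1 k.2 q.2.1 q.2.2.1) else 0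
       let ψ : ((Edge 3 L × Fin 2 × Fin 2 × Bool) → ℝ) → ℝ := fun y =>
          β' * ∑ p : Plaquette 3 L, (rootedLoop (fun (e : Edge 3 L) (i j : Fin 2) =>
            ((y (e, i, j, false) : ℝ) : ℂ) + ((y (e, i, j, true) : ℝ) : ℂ) * Complex.I) (p.1, p.2.1.1) p.2.1.2 false).trace.re
       1 / 2 * (∑ i, fderiv ℝ ψ x (Pi.single i 1) * b₀ i +
            1 / 2 * ∑ i, ∑ j, fderiv ℝ (fun z => fderiv ℝ ψ z (Pi.single i 1)) x (Pi.single j 1) * ∑ n, σ i n * σ j n) +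
          1 / 8 * ∑ i, ∑ j, fderiv ℝ ψ x (Pi.single i 1) * fderiv ℝ ψ x (Pi.single j 1) * ∑ n, σ i n * σ j n)
    let Tw : ℝ → GaugeConfig 3 L (Matrix.specialUnitaryGroup (Fin 2) ℂ) → ℝ := fun τ V =>
      ∑ l, c l * Real.exp (-(∑ e, (m l e : ℝ) * ((m l e : ℝ) + 2) / 2) * τ) *
        ∏ e, gegenbauerSum 1 (m l e) (hsForm 2 (fundamentalRep (Fin 2) (g l e)) (fundamentalRep (Fin 2) (V e)) / 2)
    Continuous (fun s : ℝ => ∫ ω, Real.exp (-(1 / 2 : ℝ) * ψV (U x s.toNNReal ω)) *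
        (Vh (U x s.toNNReal ω) * Tw ((t : ℝ) - s) (U x s.toNNReal ω)) ∂P) ∧
    ∫ ω, Real.exp (-(1 / 2 : ℝ) * ψV (U x t ω)) * Tw 0 (U x t ω) ∂P =
      Real.exp (-(1 / 2 : ℝ) * ψV x) * Tw t x -
        ∫ s in (0 : ℝ)..(t : ℝ), ∫ ω, Real.exp (-(1 / 2 : ℝ) * ψV (U x s.toNNReal ω)) *
          (Vh (U x s.toNNReal ω) * Tw ((t : ℝ) - s) (U x s.toNNReal ω)) ∂P := by
  intro ψV Vh Tw
  classical
  haveI := secondCountableTopology_su2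
  haveI := borelSpace_config L
  -- ### the objects in flat coordinates
  set ψ : ((Edge 3 L × Fin 2 × Fin 2 × Bool) → ℝ) → ℝ := fun y =>
      β' * ∑ p : Plaquette 3 L, (rootedLoop (fun (e : Edge 3 L) (i j : Fin 2) =>
        ((y (e, i, j, false) : ℝ) : ℂ) + ((y (e, i, j, true) : ℝ) : ℂ) * Complex.I) (p.1, p.2.1.1) p.2.1.2 false).trace.re
    with hψdef
  set Fh : κ → ((Edge 3 L × Fin 2 × Fin 2 × Bool) → ℝ) → ℝ := fun l y => ∏ e, gegenbauerSum 1 (m l e)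
      ((∑ i, ∑ j, (((fundamentalRep (Fin 2) (g l e) : Matrix (Fin 2) (Fin 2) ℂ) i j).re * y (e, i, j, false) +
        ((fundamentalRep (Fin 2) (g l e) : Matrix (Fin 2) (Fin 2) ℂ) i j).im * y (e, i, j, true))) / 2) with hFhdef
  let χ : ContDiffBump (0 : (Edge 3 L × Fin 2 × Fin 2 × Bool) → ℝ) := ⟨2, 3, by norm_num, by norm_num⟩
  have hχ : (2 : ℝ) ≤ χ.rIn := le_rfl
  set f : κ → ((Edge 3 L × Fin 2 × Fin 2 × Bool) → ℝ) → ℝ := fun l y =>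
      (χ : ((Edge 3 L × Fin 2 × Fin 2 × Bool) → ℝ) → ℝ) y * (Real.exp (-(1 / 2 : ℝ) * ψ y) * Fh l y) with hfdef
  set lam : κ → ℝ := fun l => ∑ e, (m l e : ℝ) * ((m l e : ℝ) + 2) / 2 with hlamdef
  set a : κ → ℝ → ℝ := fun l s => c l * Real.exp (-(lam l) * ((t : ℝ) - s)) with hadef
  set a' : κ → ℝ → ℝ := fun l s => lam l * a l s with ha'def
  -- the coordinate map, the flat generator of the `f l`
  set coords : GaugeConfig 3 L (Matrix.specialUnitaryGroup (Fin 2) ℂ) → (Edge 3 L × Fin 2 × Fin 2 × Bool → ℝ) :=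
    fun V q => (fun z : ℂ => if q.2.2.2 then z.im else z.re)
      ((fundamentalRep (Fin 2) (V q.1) : Matrix (Fin 2) (Fin 2) ℂ) q.2.1 q.2.2.1) with hcoords
  set gen : κ → GaugeConfig 3 L (Matrix.specialUnitaryGroup (Fin 2) ℂ) → ℝ := fun l V =>
      (∑ i : Edge 3 L × Fin 2 × Fin 2 × Bool, fderiv ℝ (f l) (coords V) (Pi.single i 1) *
          (fun z : ℂ => if i.2.2.2 then z.im else z.re)
            ((latticeLangevinDynamics (fundamentalLatticeRep 2) β').drift
              (matrixConfig (fundamentalRep (Fin 2)) V) i.1 i.2.1 i.2.2.1) +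
      1 / 2 * ∑ i : Edge 3 L × Fin 2 × Fin 2 × Bool, ∑ j : Edge 3 L × Fin 2 × Fin 2 × Bool,
        fderiv ℝ (fun z => fderiv ℝ (f l) z (Pi.single i 1)) (coords V) (Pi.single j 1) *
          ∑ n : Edge 3 L × NoiseIdx 2,
            (if n.1 = i.1 then (fun z : ℂ => if i.2.2.2 then z.im else z.re)
              ((latticeLangevinDynamics (fundamentalLatticeRep 2) β').noise
                (matrixConfig (fundamentalRep (Fin 2)) V) i.1 n.2 i.2.1 i.2.2.1) else 0) *
            (if n.1 = j.1 then (fun z : ℂ => if j.2.2.2 then z.im else z.re)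
              ((latticeLangevinDynamics (fundamentalLatticeRep 2) β').noise
                (matrixConfig (fundamentalRep (Fin 2)) V) j.1 n.2 j.2.1 j.2.2.1) else 0)) with hgendef
  -- values at group points
  have hcoords_ball : ∀ V : GaugeConfig 3 L (Matrix.specialUnitaryGroup (Fin 2) ℂ),
      coords V ∈ closedBall (0 : (Edge 3 L × Fin 2 × Fin 2 × Bool) → ℝ) χ.rIn := by
    intro V
    rw [mem_closedBall, dist_zero_right]
    exact (norm_coords_le_one V).trans (by norm_num : (1 : ℝ) ≤ 2)
  have hψV : ∀ V : GaugeConfig 3 L (Matrix.specialUnitaryGroup (Fin 2) ℂ), ψV V = ψ (coords V) := fun V => rfl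
  have hFhV : ∀ (l : κ) (V : GaugeConfig 3 L (Matrix.specialUnitaryGroup (Fin 2) ℂ)), Fh l (coords V) =
      ∏ e, gegenbauerSum 1 (m l e) (hsForm 2 (fundamentalRep (Fin 2) (g l e)) (fundamentalRep (Fin 2) (V e)) / 2) := by
    intro l V
    rw [hFhdef]
    have h := fun e => latitude_coords (fun e => (fundamentalRep (Fin 2) (g l e) : Matrix (Fin 2) (Fin 2) ℂ))
      (fun e => (fundamentalRep (Fin 2) (V e) : Matrix (Fin 2) (Fin 2) ℂ)) e
    simp only [hcoords, Bool.false_eq_true, ↓reduceIte] at h ⊢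
    exact Finset.prod_congr rfl fun e _ => by rw [h e]
  have hfval : ∀ (l : κ) (V : GaugeConfig 3 L (Matrix.specialUnitaryGroup (Fin 2) ℂ)), f l (coords V) =
      Real.exp (-(1 / 2 : ℝ) * ψV V) *
        ∏ e, gegenbauerSum 1 (m l e) (hsForm 2 (fundamentalRep (Fin 2) (g l e)) (fundamentalRep (Fin 2) (V e)) / 2) := by
    intro l V
    simp only [hfdef]
    rw [χ.one_of_mem_closedBall (hcoords_ball V), one_mul, hFhV, hψV]
  -- ### the generator at group points
  have hgen : ∀ (l : κ) (V : GaugeConfig 3 L (Matrix.specialUnitaryGroup (Fin 2) ℂ)), gen l V =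
      Real.exp (-(1 / 2 : ℝ) * ψV V) * ((-(lam l)) *
          ∏ e, gegenbauerSum 1 (m l e) (hsForm 2 (fundamentalRep (Fin 2) (g l e)) (fundamentalRep (Fin 2) (V e)) / 2) -
        Vh V * ∏ e, gegenbauerSum 1 (m l e) (hsForm 2 (fundamentalRep (Fin 2) (g l e)) (fundamentalRep (Fin 2) (V e)) / 2)) := by
    intro l V
    have h := generator_groundState_ridge (L := L) β' (g l) V (m l) χ hχ
    dsimp only at h
    rw [hgendef, hψV, ← hFhV l V]
    dsimp only [Vh]
    exact h
  -- ### smoothness, compact support, the time coefficients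
  have hψ3 : ContDiff ℝ 3 ψ := contDiff_psiHat (d := 3) (L := L) (N := 2) (n := 3) β'
  have hFh3 : ∀ l, ContDiff ℝ 3 (Fh l) := by
    intro l
    obtain ⟨ℓ, hℓ⟩ := latitude_eq_clm (L := L) (fun e => (fundamentalRep (Fin 2) (g l e) : Matrix (Fin 2) (Fin 2) ℂ))
    have hΦ : ContDiff ℝ 3 (fun s : Edge 3 L → ℝ => ∏ e, gegenbauerSum 1 (m l e) (s e)) :=
      contDiff_prod (fun e _ => (contDiff_gegenbauerSum 1 (m l e)).comp (contDiff_apply ℝ ℝ e))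
    have heq : Fh l = fun y => (fun s : Edge 3 L → ℝ => ∏ e, gegenbauerSum 1 (m l e) (s e)) (ℓ y) := by
      funext y; simp only [hFhdef, hℓ]
    rw [heq]; exact hΦ.comp ℓ.contDiff
  have hf3 : ∀ l, ContDiff ℝ 3 (f l) := fun l =>
    (χ.contDiff (n := 3)).mul ((Real.contDiff_exp.comp (contDiff_const.mul hψ3)).mul (hFh3 l))
  have hfc : ∀ l, HasCompactSupport (f l) := fun l => by
    rw [hfdef]; exact χ.hasCompactSupport.mul_right
  have hader : ∀ l r, HasDerivAt (a l) (a' l r) r := by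
    intro l r
    have h1 : HasDerivAt (fun s : ℝ => -(lam l) * ((t : ℝ) - s)) (lam l) r := by
      have h := (((hasDerivAt_id r).const_sub (t : ℝ)).const_mul (-(lam l)))
      exact h.congr_deriv (by simp)
    have h2 := (h1.exp).const_mul (c l)
    refine h2.congr_deriv ?_
    simp only [ha'def, hadef]; ring
  have hac : ∀ l, Continuous (a l) := fun l =>
    continuous_iff_continuousAt.2 fun r => (hader l r).continuousAt
  have ha'c : ∀ l, Continuous (a' l) := fun l => continuous_const.mul (hac l)
  -- ### the pointwise identity `Σ_l (a'_l f_l + a_l gen_l) = -φ̂ V̂ T̂_{t-r} w` at group points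
  have hterm : ∀ (r : ℝ) (V : GaugeConfig 3 L (Matrix.specialUnitaryGroup (Fin 2) ℂ)),
      ∑ l, (a' l r * f l (coords V) + a l r * gen l V) =
        -(Real.exp (-(1 / 2 : ℝ) * ψV V) * (Vh V * Tw ((t : ℝ) - r) V)) := by
    intro r V
    have hl : ∀ l, a' l r * f l (coords V) + a l r * gen l V =
        -(Real.exp (-(1 / 2 : ℝ) * ψV V) * (Vh V * (c l * Real.exp (-(lam l) * ((t : ℝ) - r)) *
          ∏ e, gegenbauerSum 1 (m l e) (hsForm 2 (fundamentalRep (Fin 2) (g l e)) (fundamentalRep (Fin 2) (V e)) / 2)))) := by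
      intro l
      rw [hfval, hgen]
      simp only [ha'def, hadef]
      ring
    simp only [hl, Tw]
    rw [Finset.sum_neg_distrib, Finset.mul_sum, Finset.mul_sum]
  -- ### the time-dependent Dynkin formula
  have hD := dynkin_separable (L := L) β' hW U hU hUm x hf3 hfc hader ha'c (t := (t : ℝ)) t.2
  dsimp only at hD
  have htt : ((t : ℝ)).toNNReal = t := Real.toNNReal_coe
  -- continuity of the integrand (via `dynkin_forward`, observable by observable)
  have hfw := fun l => dynkin_forward (L := L) β' hW U hU hUm x (hf3 l) (hfc l)
  have hmeasU : ∀ τ : ℝ≥0, Measurable (U x τ) := fun τ => ((hU x).2.adapted τ).mono (hW.natFiltration.le τ) le_rfl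
  have hco : Continuous coords := continuous_coords (L := L)
  have hObs_cont : ∀ l, Continuous fun V => f l (coords V) := fun l => (hf3 l).continuous.comp hco
  have hgen_cont : ∀ l, Continuous (gen l) := fun l => continuous_generator (L := L) β' ((hf3 l).of_le (by norm_num))
  have hint_f : ∀ l (r : ℝ≥0), Integrable (fun ω => f l (coords (U x r ω))) P := by
    intro l r
    obtain ⟨M, -, hM⟩ := exists_abs_le_of_continuous (hObs_cont l)
    exact Integrable.of_bound ((hObs_cont l).measurable.comp (hmeasU r)).aestronglyMeasurable M
      (Eventually.of_forall fun ω => by rw [Real.norm_eq_abs]; exact hM _)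
  have hint_g : ∀ l (r : ℝ≥0), Integrable (fun ω => gen l (U x r ω)) P := by
    intro l r
    obtain ⟨M, -, hM⟩ := exists_abs_le_of_continuous (hgen_cont l)
    exact Integrable.of_bound ((hgen_cont l).measurable.comp (hmeasU r)).aestronglyMeasurable M
      (Eventually.of_forall fun ω => by rw [Real.norm_eq_abs]; exact hM _)
  have hswap : ∀ r : ℝ, ∫ ω, Real.exp (-(1 / 2 : ℝ) * ψV (U x r.toNNReal ω)) *
      (Vh (U x r.toNNReal ω) * Tw ((t : ℝ) - r) (U x r.toNNReal ω)) ∂P =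
      -∑ l, (a' l r * ∫ ω, f l (coords (U x r.toNNReal ω)) ∂P + a l r * ∫ ω, gen l (U x r.toNNReal ω) ∂P) := by
    intro r
    have h1 : (fun ω => Real.exp (-(1 / 2 : ℝ) * ψV (U x r.toNNReal ω)) *
        (Vh (U x r.toNNReal ω) * Tw ((t : ℝ) - r) (U x r.toNNReal ω))) =
        fun ω => -∑ l, (a' l r * f l (coords (U x r.toNNReal ω)) + a l r * gen l (U x r.toNNReal ω)) := by
      funext ω; rw [hterm, neg_neg]
    rw [h1, integral_neg, integral_finsetSum _ fun l _ => ?_]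
    · congr 1
      refine Finset.sum_congr rfl fun l _ => ?_
      rw [integral_add ((hint_f l _).const_mul _) ((hint_g l _).const_mul _), MeasureTheory.integral_const_mul,
        MeasureTheory.integral_const_mul]
    · exact ((hint_f l _).const_mul _).add ((hint_g l _).const_mul _)
  have hcont : Continuous (fun s : ℝ => ∫ ω, Real.exp (-(1 / 2 : ℝ) * ψV (U x s.toNNReal ω)) *
      (Vh (U x s.toNNReal ω) * Tw ((t : ℝ) - s) (U x s.toNNReal ω)) ∂P) := by
    simp_rw [hswap]
    refine (continuous_finsetSum _ fun l _ => ?_).neg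
    exact ((ha'c l).mul (hfw l).1).add ((hac l).mul (hfw l).2.1)
  refine ⟨hcont, ?_⟩
  -- the three pieces of the Dynkin identity
  have hL : ∫ ω, ∑ l, a l (t : ℝ) * f l (coords (U x ((t : ℝ)).toNNReal ω)) ∂P =
      ∫ ω, Real.exp (-(1 / 2 : ℝ) * ψV (U x t ω)) * Tw 0 (U x t ω) ∂P := by
    rw [htt]
    refine integral_congr_ae (Eventually.of_forall fun ω => ?_)
    simp only [hfval, hadef, Tw, sub_self, mul_zero, Real.exp_zero, mul_one, Finset.mul_sum]
    exact Finset.sum_congr rfl fun l _ => by ring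
  have h0 : ∑ l, a l 0 * f l (coords x) = Real.exp (-(1 / 2 : ℝ) * ψV x) * Tw t x := by
    simp only [hfval, hadef, Tw, sub_zero, Finset.mul_sum]
    exact Finset.sum_congr rfl fun l _ => by ring
  have hI : ∫ r in (0 : ℝ)..(t : ℝ), ∫ ω, ∑ l, (a' l r * f l (coords (U x r.toNNReal ω)) + a l r * gen l (U x r.toNNReal ω)) ∂P =
      -∫ s in (0 : ℝ)..(t : ℝ), ∫ ω, Real.exp (-(1 / 2 : ℝ) * ψV (U x s.toNNReal ω)) *
          (Vh (U x s.toNNReal ω) * Tw ((t : ℝ) - s) (U x s.toNNReal ω)) ∂P := by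
    rw [← intervalIntegral.integral_neg]
    refine intervalIntegral.integral_congr fun r _ => ?_
    rw [← integral_neg]
    refine integral_congr_ae (Eventually.of_forall fun ω => ?_)
    show ∑ l, (a' l r * f l (coords (U x r.toNNReal ω)) + a l r * gen l (U x r.toNNReal ω)) = _
    rw [hterm]
  rw [hL, h0, hI] at hD
  rw [hD]; ring

end Summit.QuantumFields.YangMills.Theorems.ColdStartUniversality

end
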